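import Summits.BirchSwinnertonDyer.BirchSwinnertonDyer.Theorems.SignedLowerHalvesSmallImageLowerHalfBothSignsRttD2SeqSemilocLocalCount
import Summits.BirchSwinnertonDyer.BirchSwinnertonDyer.Theorems.SignedLowerHalvesSmallImageLowerHalfBothSignsRttD2SeqSemilocUnramified
import Summits.BirchSwinnertonDyer.BirchSwinnertonDyer.Theorems.SignedLowerHalvesSmallImageLowerHalfBothSignsRttD2SeqSemilocLambda
import HarnessLib

/-!
# Route `SignedLowerHalves`, crux L `SmallImageLowerHalfBothSigns` (stmt-BirchSwinnertonDyer-23599), line `rtt_w3` v30 — stub S3β″ (`stub_junctionPT_ns`), input N5-(iii):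
# THE LOCAL COUNT `λ(Λ_𝒪/(E)) ≤ λ(H′)` FROM UNRAMIFIED GENERATORS — one `u_w ∈ 𝐇¹_{Iw,w}` per `w ∈ T`, unramified at every level, with `Ann_{Λ_𝒪}(u_w) = (P_w)`

WIDTH seat `bsd-line-slh-p3-w3` g26 under LEAD `cruxlead-stmt-BirchSwinnertonDyer-23599` g14 (cell `bsd-ssimc`); helper `--supports stmt-BirchSwinnertonDyer-23599`. THEOREMS ONLY (no definition,
no named fact, no instance, no `sorry`). HONEST FRAMING: packaging — it turns the GENERIC local count (`…RttD2SeqSemilocLocalCount`, p817381: per-place injections) into the form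
«one unramified generator with exact annihilator per place», which is what the local arithmetic produces: `u_w` = the compatible family of the unramified classes `Frob_w ↦ δ_{1·U_n} ⊗ ζ_k`
(tree `geomCocycle` / `infOne`), `(P_w) ⊆ Ann(u_w)` by honda's (L1) germ (p805939), `Ann(u_w) ⊆ (P_w)` from `H¹_ur(K_w, Maps(Γ_K⧸U_n, X_k)) ≅ Λ_𝒪/(p^k, ω_n, P_w)` and `⋂_{n,k} = (P_w)`.
THAT generator (hypothesis `hgen`) is NOT constructed here and is the LAST OPEN INPUT of S3β″ (with it: S3β″ = lambda-p1 split ∘ le_trans (this file) (p816814 + p818012)).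
Nothing about S3β″, crux L or BSD is proved; all remain OPEN and are proved for NO curve.

* §1 `SemilocIwasawaCohomologyDataO.exists_injective_of_annihilator_eq` — `Ann(u) = (P)` ⟹ an injective `Λ_𝒪`-linear `Λ_𝒪/(P) → L.H`, `[f] ↦ f • u`.
* §2 `single_mem_unramifiedFamilies` — a family supported at one place `w` with all levels unramified lies in `H′ = unramifiedFamilies`.
* §3 ★★★ `lambdaInvariant_quotient_span_le_unramifiedFamilies_of_generators` — `λ(Λ_𝒪 ⧸ (C(p^d)·∏_{w∈T} P_w)) ≤ λ(unramifiedFamilies …)` from `hgen` (+ T5's `hfin`/`htors` for `Π`).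
References: [Washington1997] §13.2; [GreenbergVatsal2000] §2 Prop. (2.4); [PerrinRiou1994Invent] §1.3; [Rubin2000] Thm. 1.7.3, App. B.3.
-/

set_option autoImplicit false
set_option linter.dupNamespace false -- D-0017: single-problem summit, the namespace repeats the problem name by design
noncomputable section

open scoped Classical
open NumberField IsDedekindDomain Field

namespace Summit.BirchSwinnertonDyer.BirchSwinnertonDyer.Theorems.SmallImageRttD2Seq

open Literature.NumberTheory.EllipticCurves Literature.NumberTheory.GaloisRepresentations Literature.NumberTheory.GaloisRepresentations.DiscreteGaloisModule
  Literature.NumberTheory.ComplexMultiplication.EllipticUnits.JohnsonLeungKings2011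
  Summit.BirchSwinnertonDyer.BirchSwinnertonDyer.Theorems.SmallImageRttD2J1

/-! ## §1. From an exact annihilator to an injection -/

section Ann

variable {K : Type} [Field K] [NumberField K] {p : ℕ} [Fact p.Prime] {S : Set (PadicAlgCl p)} {κ : ZpExtension K p} {γ : absoluteGaloisGroup K}
  {θ' : absoluteGaloisGroup K →ₜ* (padicCoeffIntegers S)ˣ} {P : Set (HeightOneSpectrum (𝓞 K))} {w : HeightOneSpectrum (𝓞 K)} {i : ℕ}

/-- **`Ann_{Λ_𝒪}(u) = (a)` ⟹ `Λ_𝒪/(a) ↪ L.H`, `[f] ↦ f • u`** (the orbit map of `u` descended to the quotient; injective exactly because the annihilator is `(a)`). [folklore] -/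
theorem SemilocIwasawaCohomologyDataO.exists_injective_of_annihilator_eq (L : SemilocIwasawaCohomologyDataO S κ γ θ' P w i) (u : L.H) (a : IwasawaAlgebraO S)
    (hann : ∀ f : IwasawaAlgebraO S, f • u = 0 ↔ f ∈ Ideal.span {a}) :
    ∃ g : (IwasawaAlgebraO S ⧸ Ideal.span {a}) →ₗ[IwasawaAlgebraO S] L.H, Function.Injective g ∧ ∀ f : IwasawaAlgebraO S, g (Ideal.Quotient.mk (Ideal.span {a}) f) = f • u := by
  have hker : LinearMap.ker (LinearMap.toSpanSingleton (IwasawaAlgebraO S) L.H u) = Ideal.span {a} := by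
    ext f
    rw [LinearMap.mem_ker, LinearMap.toSpanSingleton_apply]
    exact hann f
  refine ⟨(Ideal.span {a}).liftQ (LinearMap.toSpanSingleton (IwasawaAlgebraO S) L.H u) hker.ge, ?_, fun f ↦ ?_⟩
  · rw [← LinearMap.ker_eq_bot]
    exact Submodule.ker_liftQ_eq_bot _ _ _ hker.le
  · exact (Submodule.liftQ_apply _ _ f).trans (LinearMap.toSpanSingleton_apply _ _ _ _)

end Ann

/-! ## §2. Families supported at one place -/

section Single

variable {K : Type} [Field K] [NumberField K] {p : ℕ} [Fact p.Prime] (S : Set (PadicAlgCl p)) [FiniteDimensional ℚ_[p] (padicCoeffField S)] (κ : ZpExtension K p)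
  (γ : absoluteGaloisGroup K) (θ' : absoluteGaloisGroup K →ₜ* (padicCoeffIntegers S)ˣ) (P : Set (HeightOneSpectrum (𝓞 K))) (S₀ : Set (HeightOneSpectrum (𝓞 K)))

omit [FiniteDimensional ℚ_[p] (padicCoeffField S)] in
/-- **A family supported at ONE place `w`, with all levels of its `w`-component unramified, lies in `H′ = unramifiedFamilies`.** [cite: Rubin2000, App. B.3] [folklore] -/
theorem single_mem_unramifiedFamilies {w : HeightOneSpectrum (𝓞 K)} (hw : w ∈ S₀) (u : (semilocIwasawaCohomologyDataO S κ γ θ' P w 1).H)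
    (hu : w ∉ P → ∀ n k : ℕ, (semilocIwasawaCohomologyDataO S κ γ θ' P w 1).proj n k u ∈ unramifiedLevelΛ S κ γ θ' P w n k) :
    Pi.single (M := fun v : S₀ ↦ (semilocIwasawaCohomologyDataO S κ γ θ' P v 1).H) ⟨w, hw⟩ u ∈ unramifiedFamilies S κ γ θ' P S₀ := by
  intro n k v hvP
  by_cases hv : v = ⟨w, hw⟩
  · subst hv
    rw [Pi.single_eq_same]
    exact hu hvP n k
  · rw [Pi.single_eq_of_ne hv, map_zero]
    exact zero_mem _

end Single

/-! ## §3. The local count from unramified generators -/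

section Count

variable {K : Type} [Field K] [NumberField K] {p : ℕ} [Fact p.Prime] (S : Set (PadicAlgCl p)) [FiniteDimensional ℚ_[p] (padicCoeffField S)] (κ : ZpExtension K p)
  (γ : absoluteGaloisGroup K) (θ' : absoluteGaloisGroup K →ₜ* (padicCoeffIntegers S)ˣ) (P : Set (HeightOneSpectrum (𝓞 K))) (S₀ : Set (HeightOneSpectrum (𝓞 K)))

/-- ★★★ **N5-(iii) FROM UNRAMIFIED GENERATORS.** Let `T ⊆ S₀` be finite, `P_w ∈ Λ_𝒪` non-zero (`w ∈ T`), `d ∈ ℕ`, and suppose `Π_{w∈S₀} 𝐇¹_{Iw,w}` (constructed data) is finitely generated torsion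
over `Λ` (N5-(i), `moduleFinite_and_isTorsion_pi_semiloc`). IF for every `w ∈ T` there is `u_w ∈ 𝐇¹_{Iw,w}` with ALL levels unramified (when `w ∉ P`) and EXACT annihilator
`Ann_{Λ_𝒪}(u_w) = (P_w)`, THEN `λ(Λ_𝒪 ⧸ (C(p^d) · ∏_{w∈T} P_w)) ≤ λ(unramifiedFamilies …)` — with `P_w = ι((1+T)^{x_w}) − C(θ′(φ_w)χ_cyc(φ_w))` the left side is `λ(Λ_𝒪 ⧸ (JunctionDepletion S θ′ T φ x d))`
and the right side is the `λ(H′)` of `lambdaInvariant_unramifiedFamilies_le` (p816814). [cite: Washington1997, §13.2] [cite: GreenbergVatsal2000, §2 Prop. (2.4)] [cite: PerrinRiou1994Invent, §1.3]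
[cite: Rubin2000, Thm. 1.7.3, App. B.3] -/
theorem lambdaInvariant_quotient_span_le_unramifiedFamilies_of_generators (T : Finset (HeightOneSpectrum (𝓞 K))) (hTS : ∀ w ∈ T, w ∈ S₀)
    (Pw : HeightOneSpectrum (𝓞 K) → IwasawaAlgebraO S) (hP : ∀ w ∈ T, Pw w ≠ 0) (d : ℕ)
    (hfin : letI : ∀ w : HeightOneSpectrum (𝓞 K), Module (IwasawaAlgebra p) (semilocIwasawaCohomologyDataO S κ γ θ' P w 1).H :=
        fun w ↦ (semilocIwasawaCohomologyDataO S κ γ θ' P w 1).moduleIwasawa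
      Module.Finite (IwasawaAlgebra p) (∀ w : S₀, (semilocIwasawaCohomologyDataO S κ γ θ' P w 1).H))
    (htors : letI : ∀ w : HeightOneSpectrum (𝓞 K), Module (IwasawaAlgebra p) (semilocIwasawaCohomologyDataO S κ γ θ' P w 1).H :=
        fun w ↦ (semilocIwasawaCohomologyDataO S κ γ θ' P w 1).moduleIwasawa
      Module.IsTorsion (IwasawaAlgebra p) (∀ w : S₀, (semilocIwasawaCohomologyDataO S κ γ θ' P w 1).H))
    (hgen : ∀ w ∈ T, ∃ u : (semilocIwasawaCohomologyDataO S κ γ θ' P w 1).H,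
      (∀ f : IwasawaAlgebraO S, f • u = 0 ↔ f ∈ Ideal.span {Pw w}) ∧
        (w ∉ P → ∀ n k : ℕ, (semilocIwasawaCohomologyDataO S κ γ θ' P w 1).proj n k u ∈ unramifiedLevelΛ S κ γ θ' P w n k)) :
    letI : Algebra (IwasawaAlgebra p) (IwasawaAlgebraO S) := (iwasawaToIwasawaO S).toAlgebra
    letI : ∀ w : HeightOneSpectrum (𝓞 K), Module (IwasawaAlgebra p) (semilocIwasawaCohomologyDataO S κ γ θ' P w 1).H :=
      fun w ↦ (semilocIwasawaCohomologyDataO S κ γ θ' P w 1).moduleIwasawa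
    haveI : ∀ w : HeightOneSpectrum (𝓞 K), IsScalarTower (IwasawaAlgebra p) (IwasawaAlgebraO S) (semilocIwasawaCohomologyDataO S κ γ θ' P w 1).H :=
      fun w ↦ (semilocIwasawaCohomologyDataO S κ γ θ' P w 1).isScalarTower_moduleIwasawa
    lambdaInvariant p (IwasawaAlgebraO S ⧸ Ideal.span {PowerSeries.C ((p : padicCoeffIntegers S) ^ d) * ∏ w ∈ T, Pw w}) ≤
      lambdaInvariant p (unramifiedFamilies S κ γ θ' P S₀) := by
  letI : Algebra (IwasawaAlgebra p) (IwasawaAlgebraO S) := (iwasawaToIwasawaO S).toAlgebra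
  letI : ∀ w : HeightOneSpectrum (𝓞 K), Module (IwasawaAlgebra p) (semilocIwasawaCohomologyDataO S κ γ θ' P w 1).H :=
    fun w ↦ (semilocIwasawaCohomologyDataO S κ γ θ' P w 1).moduleIwasawa
  haveI : ∀ w : HeightOneSpectrum (𝓞 K), IsScalarTower (IwasawaAlgebra p) (IwasawaAlgebraO S) (semilocIwasawaCohomologyDataO S κ γ θ' P w 1).H :=
    fun w ↦ (semilocIwasawaCohomologyDataO S κ γ θ' P w 1).isScalarTower_moduleIwasawa
  haveI := hfin
  haveI : IsNoetherian (IwasawaAlgebra p) (∀ w : S₀, (semilocIwasawaCohomologyDataO S κ γ θ' P w 1).H) := isNoetherian_of_isNoetherianRing_of_finite _ _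
  haveI : Module.Finite (IwasawaAlgebra p) (unramifiedFamilies S κ γ θ' P S₀) :=
    Module.Finite.of_injective ((unramifiedFamilies S κ γ θ' P S₀).subtype.restrictScalars (IwasawaAlgebra p)) (Submodule.subtype_injective _)
  have htorsH : Module.IsTorsion (IwasawaAlgebra p) (unramifiedFamilies S κ γ θ' P S₀) := isTorsion_submodule_of_isTorsion _ htors
  -- the generators and their injections
  have hg : ∀ w : HeightOneSpectrum (𝓞 K), ∃ g : (IwasawaAlgebraO S ⧸ Ideal.span {Pw w}) →ₗ[IwasawaAlgebraO S] (semilocIwasawaCohomologyDataO S κ γ θ' P w 1).H,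
      w ∈ T → Function.Injective g ∧ ∀ b, w ∉ P → ∀ n k : ℕ, (semilocIwasawaCohomologyDataO S κ γ θ' P w 1).proj n k (g b) ∈ unramifiedLevelΛ S κ γ θ' P w n k := by
    intro w
    by_cases hw : w ∈ T
    · obtain ⟨u, hann, hur⟩ := hgen w hw
      obtain ⟨g, hginj, hgval⟩ := (semilocIwasawaCohomologyDataO S κ γ θ' P w 1).exists_injective_of_annihilator_eq u (Pw w) hann
      refine ⟨g, fun _ ↦ ⟨hginj, fun b hwP n k ↦ ?_⟩⟩
      obtain ⟨f, rfl⟩ := Ideal.Quotient.mk_surjective b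
      rw [hgval, proj_semilocIwasawaCohomologyDataO_smul]
      exact (unramifiedLevelΛ S κ γ θ' P w n k).smul_mem f (hur hwP n k)
    · exact ⟨0, fun h ↦ absurd h hw⟩
  choose g hg using hg
  exact lambdaInvariant_quotient_span_le_of_single_mem (fun _ ↦ rfl) S₀ T hTS Pw hP d (fun w ↦ (semilocIwasawaCohomologyDataO S κ γ θ' P w 1).H)
    (unramifiedFamilies S κ γ θ' P S₀) htorsH g (fun w hw ↦ (hg w hw).1)
    (fun w hw b ↦ single_mem_unramifiedFamilies S κ γ θ' P S₀ (hTS w hw) (g w b) (fun hwP n k ↦ (hg w hw).2 b hwP n k))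

end Count

end Summit.BirchSwinnertonDyer.BirchSwinnertonDyer.Theorems.SmallImageRttD2Seq

end
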